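import Mathlib.Analysis.SpecialFunctions.Complex.Log
import Literature.Algebra.Polynomial.AffineSliceCalculus
import Literature.NumberTheory.Transcendental.OneMotiveToricProofs
import Literature.NumberTheory.Transcendental.GammaMonomialsProofs
import HarnessLib

/-!
# Rigidity of plane curves through a coset of the period lattice `u + 2πi ℚ²`

Let `c = 2πi` and `u ∈ ℂ²` with `e^{u₀}, e^{u₁}` algebraic. Suppose a non-zero polynomial
`G ∈ ℚ̄[X₀, X₁]` becomes, after the affine substitution `Xⱼ ↦ uⱼ + c Xⱼ`, a complex multiple of a
*rational* polynomial: `G(u + cV) = μ · S(V)` with `S ∈ ℚ[V₀, V₁]`. (This is the situation of an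
irreducible plane curve `D = Z(G) ⊆ Z(R)`, `R ∈ ℚ[X]`, containing infinitely many points of
`u + c ℤ²`: the Zariski closure of those points is defined over `ℚ`.) The main result
`not_linearIndependent_of_bind₁_affine_eq` says that then **every point of `Z(G)` of the form
`u + c v`, `v ∈ ℚ²`, has `ℚ`-linearly dependent coordinates.** In particular such a curve carries
no `ℚ`-linearly independent logarithmic point of this shape — the "constant exponential" class in
the finiteness of independent exponential points on `ℚ`-curves of `ℂ² × ℂ²`.

The proof is an elementary descent using only Hermite–Lindemann (`transcendental_exp_holds`: a
non-zero algebraic number has transcendental exponential) and the transcendence of `π`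
(`transcendental_pi_holds`, through `transcendental_two_pi_I`), no Baker: writing `G` as a polynomial in `X₀` with coefficient
polynomials ("slices") in `X₁` and comparing the identity slice by slice
(`Literature.Algebra.Polynomial.finTwoSlice_bind₁_affine`), the top two coefficients of a slice
identity `g(a + cT) = μ' s(T)` (`g ∈ ℚ̄[T]`, `s ∈ ℚ[T]`) produce a relation
`algebraic = ρ c - e a` with `ρ ∈ ℚ`, which Hermite–Lindemann turns into the `ℚ`-linear relation
`e a = ρ c`; according to the `ℚ`-rank of `(u₀, u₁, c)` one normalises coordinates by a rational
linear change and concludes that `G = γ X₀^J` in adapted coordinates (`engine_false`,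
`eq_C_mul_X_pow_of_bind₁_affine_eq`, `false_of_bind₁_affine_eq_of_forall`).
-/

noncomputable section

open Polynomial Complex
open Literature.Algebra.Polynomial

namespace Literature.NumberTheory.Transcendental.LogLattice

/-! ### Transcendence inputs: `2πi`, Hermite–Lindemann -/

/-- Positive powers of `2πi` are transcendental (Lindemann, `transcendental_two_pi_I`).
[cite: Lindemann1882] -/
theorem transcendental_twoPiI_pow {k : ℕ} (hk : k ≠ 0) :
    Transcendental ℚ ((2 * (Real.pi : ℂ) * I) ^ k) := fun h =>
  transcendental_two_pi_I (IsAlgebraic.of_pow (Nat.pos_of_ne_zero hk) h)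

/-- If `x · (2πi)^k = y` with `x, y` algebraic, `x ≠ 0` and `k ≠ 0`, contradiction.
[cite: Lindemann1882] -/
theorem false_of_mul_twoPiI_pow_eq {x y : ℂ} (hx : IsAlgebraic ℚ x) (hy : IsAlgebraic ℚ y)
    (hx0 : x ≠ 0) {k : ℕ} (hk : k ≠ 0) (h : x * (2 * (Real.pi : ℂ) * I) ^ k = y) : False := by
  apply transcendental_twoPiI_pow hk
  have : (2 * (Real.pi : ℂ) * I) ^ k = y * x⁻¹ := by
    rw [← h]; field_simp
  rw [this]
  exact hy.mul hx.inv

/-- An integer multiple of a logarithm of an algebraic number is a logarithm of an algebraic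
number: `e^{m a} = (e^a)^m`. [folklore] -/
theorem isAlgebraic_exp_int_mul {a : ℂ} (ha : IsAlgebraic ℚ (exp a)) (m : ℤ) :
    IsAlgebraic ℚ (exp ((m : ℂ) * a)) := by
  rw [Complex.exp_int_mul]
  exact KoblitzOgus.isAlgebraic_zpow ha m

/-- **Hermite–Lindemann, the form used here**: an algebraic number which is a rational combination
`β = q₀ · 2πi + q₁ a₁ + q₂ a₂` of `2πi` and two logarithms of algebraic numbers (`e^{a₁}, e^{a₂}`
algebraic) vanishes. Indeed for `N = den q₀ · den q₁ · den q₂` all `N qᵢ` are integers, so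
`e^{Nβ} = (e^{a₁})^{N q₁} (e^{a₂})^{N q₂}` is algebraic and `Nβ = 0` by Hermite–Lindemann
(`transcendental_exp_holds`). [cite: Lindemann1882] -/
theorem eq_zero_of_isAlgebraic_of_eq_combination {β a₁ a₂ : ℂ} (hβ : IsAlgebraic ℚ β)
    (h₁ : IsAlgebraic ℚ (exp a₁)) (h₂ : IsAlgebraic ℚ (exp a₂)) (q₀ q₁ q₂ : ℚ)
    (h : β = q₀ * (2 * (Real.pi : ℂ) * I) + q₁ * a₁ + q₂ * a₂) : β = 0 := by
  -- a common denominator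
  set N : ℕ := q₀.den * q₁.den * q₂.den with hN
  have hN0 : (N : ℂ) ≠ 0 := by
    rw [hN]
    exact_mod_cast (Nat.mul_ne_zero (Nat.mul_ne_zero q₀.den_nz q₁.den_nz) q₂.den_nz)
  have hd : ∀ q : ℚ, ((q.den : ℚ) : ℂ) * (q : ℂ) = ((q.num : ℚ) : ℂ) := fun q => by
    rw [← Rat.cast_mul, Rat.den_mul_eq_num]
  -- `N qᵢ` as integers
  have e0 : (N : ℂ) * q₀ = ((q₀.num * q₁.den * q₂.den : ℤ) : ℂ) := by
    have := hd q₀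
    push_cast at this ⊢
    rw [hN]
    push_cast
    linear_combination ((q₁.den : ℂ) * q₂.den) * this
  have e1 : (N : ℂ) * q₁ = ((q₁.num * q₀.den * q₂.den : ℤ) : ℂ) := by
    have := hd q₁
    push_cast at this ⊢
    rw [hN]
    push_cast
    linear_combination ((q₀.den : ℂ) * q₂.den) * this
  have e2 : (N : ℂ) * q₂ = ((q₂.num * q₀.den * q₁.den : ℤ) : ℂ) := by
    have := hd q₂
    push_cast at this ⊢
    rw [hN]
    push_cast
    linear_combination ((q₀.den : ℂ) * q₁.den) * this
  -- `exp (N β)` is algebraic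
  have hexp : IsAlgebraic ℚ (exp ((N : ℂ) * β)) := by
    have e3 : (N : ℂ) * β = ((q₀.num * q₁.den * q₂.den : ℤ) : ℂ) * (2 * Real.pi * I) +
        ((q₁.num * q₀.den * q₂.den : ℤ) : ℂ) * a₁ + ((q₂.num * q₀.den * q₁.den : ℤ) : ℂ) * a₂ := by
      rw [h, ← e0, ← e1, ← e2]; ring
    rw [e3, Complex.exp_add, Complex.exp_add, Complex.exp_int_mul_two_pi_mul_I, one_mul]
    exact (isAlgebraic_exp_int_mul h₁ _).mul (isAlgebraic_exp_int_mul h₂ _)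
  have hNβ : IsAlgebraic ℚ ((N : ℂ) * β) := (isAlgebraic_nat N).mul hβ
  by_contra hβ0
  have hne : (N : ℂ) * β ≠ 0 := mul_ne_zero hN0 hβ0
  exact transcendental_exp_holds hNβ hne hexp

/-! ### The one-variable engine -/

/-- **Engine.** Let `a ∈ ℂ` with `e^a` algebraic and `(a, 2πi)` `ℚ`-linearly independent (in the
weak form: `q a + r · 2πi = 0 ⇒ q = 0`), and let `g ∈ ℂ[T]` have algebraic coefficients and degree
`e + 1 ≥ 1`. If the two top coefficients of `g(a + 2πi·T)` are `μ σ₁`, `μ σ₀` with `σ₁, σ₀ ∈ ℚ`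
and a common `μ ∈ ℂ`, we reach a contradiction: they read `g_{e+1} c^{e+1} = μ σ₁` and
`(g_e + (e+1) a g_{e+1}) c^e = μ σ₀` (`c = 2πi`), whence `g_e / g_{e+1} = (σ₀/σ₁) c - (e+1) a` is
algebraic, so vanishes by Hermite–Lindemann, contradicting independence. [cite: Lindemann1882] -/
theorem engine_false {a μ : ℂ} (ha : IsAlgebraic ℚ (exp a))
    (hind : ∀ q r : ℚ, (q : ℂ) * a + r * (2 * (Real.pi : ℂ) * I) = 0 → q = 0)
    (g : ℂ[X]) (hg : ∀ n, IsAlgebraic ℚ (g.coeff n)) {e : ℕ} (he : g.natDegree = e + 1)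
    (σ₁ σ₀ : ℚ)
    (htop : (g.comp (C a + C (2 * (Real.pi : ℂ) * I) * X)).coeff (e + 1) = μ * σ₁)
    (hsec : (g.comp (C a + C (2 * (Real.pi : ℂ) * I) * X)).coeff e = μ * σ₀) : False := by
  set c : ℂ := 2 * (Real.pi : ℂ) * I with hc
  clear_value c
  have hc0 : c ≠ 0 := hc ▸ Complex.two_pi_I_ne_zero
  have hg0 : g ≠ 0 := by
    rintro rfl
    simp at he
  have hlead : g.coeff (e + 1) ≠ 0 := by
    rw [← he]
    exact mt leadingCoeff_eq_zero.1 hg0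
  -- the two coefficient identities
  have h1 : g.coeff (e + 1) * c ^ (e + 1) = μ * σ₁ := by
    rw [← htop, ← he, coeff_comp_affine_natDegree]
  have h2 : (g.coeff e + ((e + 1 : ℕ) : ℂ) * a * g.coeff (e + 1)) * c ^ e = μ * σ₀ := by
    rw [← hsec, coeff_comp_affine_of_natDegree_eq_succ g a c he]
  have hσ₁ : (σ₁ : ℂ) ≠ 0 := by
    intro h0
    rw [h0, mul_zero] at h1
    exact (mul_ne_zero hlead (pow_ne_zero _ hc0)) h1
  -- eliminate `μ`: `(g_e + (e+1) a g_{e+1}) σ₁ = g_{e+1} c σ₀`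
  have h3 : (g.coeff e + ((e + 1 : ℕ) : ℂ) * a * g.coeff (e + 1)) * σ₁ =
      g.coeff (e + 1) * c * σ₀ := by
    have h4 : (g.coeff e + ((e + 1 : ℕ) : ℂ) * a * g.coeff (e + 1)) * c ^ e * σ₁ =
        g.coeff (e + 1) * c ^ (e + 1) * σ₀ := by
      rw [h2, h1]; ring
    have hce : c ^ e ≠ 0 := pow_ne_zero _ hc0
    apply mul_right_cancel₀ hce
    calc (g.coeff e + ((e + 1 : ℕ) : ℂ) * a * g.coeff (e + 1)) * σ₁ * c ^ e
        = (g.coeff e + ((e + 1 : ℕ) : ℂ) * a * g.coeff (e + 1)) * c ^ e * σ₁ := by ring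
      _ = g.coeff (e + 1) * c ^ (e + 1) * σ₀ := h4
      _ = g.coeff (e + 1) * c * σ₀ * c ^ e := by ring
  -- the algebraic number `β = g_e / g_{e+1}`
  set β : ℂ := g.coeff e * (g.coeff (e + 1))⁻¹ with hβ
  have hβalg : IsAlgebraic ℚ β := (hg e).mul (hg (e + 1)).inv
  have hβeq : β = ((σ₀ / σ₁ : ℚ) : ℂ) * c + ((-(e + 1 : ℕ) : ℚ) : ℂ) * a + ((0 : ℚ) : ℂ) * 0 := by
    rw [hβ]
    push_cast at h3 ⊢
    field_simp
    linear_combination h3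
  have hβ0 : β = 0 :=
    eq_zero_of_isAlgebraic_of_eq_combination hβalg ha (by rw [Complex.exp_zero]; exact isAlgebraic_one)
      _ _ _ (hc ▸ hβeq)
  -- hence `(e+1) a = (σ₀/σ₁) c`, contradicting independence
  have hrel : (((e + 1 : ℕ) : ℚ) : ℂ) * a + ((-(σ₀ / σ₁) : ℚ) : ℂ) * c = 0 := by
    rw [hβ0] at hβeq
    push_cast at hβeq ⊢
    linear_combination hβeq
  have := hind _ _ hrel
  exact Nat.succ_ne_zero e (by exact_mod_cast this)

/-- **Engine, full-identity form**: if `g(a + 2πi T) = μ · s(T)` with `s ∈ ℚ[T]` (all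
coefficients rational) then `g` is constant. [cite: Lindemann1882] -/
theorem natDegree_eq_zero_of_comp_affine_eq {a μ : ℂ} (ha : IsAlgebraic ℚ (exp a))
    (hind : ∀ q r : ℚ, (q : ℂ) * a + r * (2 * (Real.pi : ℂ) * I) = 0 → q = 0)
    (g : ℂ[X]) (hg : ∀ n, IsAlgebraic ℚ (g.coeff n)) (s : ℂ[X]) (hs : ∀ n, ∃ q : ℚ, s.coeff n = q)
    (h : g.comp (C a + C (2 * (Real.pi : ℂ) * I) * X) = C μ * s) : g.natDegree = 0 := by
  by_contra hne
  obtain ⟨e, he⟩ := Nat.exists_eq_succ_of_ne_zero hne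
  obtain ⟨σ₁, hσ₁⟩ := hs (e + 1)
  obtain ⟨σ₀, hσ₀⟩ := hs e
  refine engine_false (μ := μ) ha hind g hg he σ₁ σ₀ ?_ ?_
  · rw [h, coeff_C_mul, hσ₁]
  · rw [h, coeff_C_mul, hσ₀]

/-- **Engine, with an additive constant**: if `g(a + 2πi T) + κ = μ · s(T)` with `s ∈ ℚ[T]` then
`deg g ≤ 1` (the constant only affects the coefficient of `T⁰`). [cite: Lindemann1882] -/
theorem natDegree_le_one_of_comp_affine_add_C_eq {a μ κ : ℂ} (ha : IsAlgebraic ℚ (exp a))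
    (hind : ∀ q r : ℚ, (q : ℂ) * a + r * (2 * (Real.pi : ℂ) * I) = 0 → q = 0)
    (g : ℂ[X]) (hg : ∀ n, IsAlgebraic ℚ (g.coeff n)) (s : ℂ[X]) (hs : ∀ n, ∃ q : ℚ, s.coeff n = q)
    (h : g.comp (C a + C (2 * (Real.pi : ℂ) * I) * X) + C κ = C μ * s) : g.natDegree ≤ 1 := by
  by_contra hlt
  push Not at hlt
  obtain ⟨e, he⟩ := Nat.exists_eq_succ_of_ne_zero (by omega : g.natDegree ≠ 0)
  have he1 : 1 ≤ e := by omega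
  obtain ⟨σ₁, hσ₁⟩ := hs (e + 1)
  obtain ⟨σ₀, hσ₀⟩ := hs e
  refine engine_false (μ := μ) ha hind g hg he σ₁ σ₀ ?_ ?_
  · have := congrArg (fun p => p.coeff (e + 1)) h
    simp only [coeff_add, coeff_C, if_neg (Nat.succ_ne_zero e), add_zero, coeff_C_mul] at this
    rw [this, hσ₁]
  · have := congrArg (fun p => p.coeff e) h
    simp only [coeff_add, coeff_C, if_neg (by omega : e ≠ 0), add_zero, coeff_C_mul] at this
    rw [this, hσ₀]

end Literature.NumberTheory.Transcendental.LogLattice
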